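import Literature.Analysis.FluidPDE.ConvexIntegration2DPlaneWavesEnergy
import Literature.Analysis.FluidPDE.ConvexIntegration2DGeometricLemma
import Mathlib.MeasureTheory.Covering.Besicovitch
import Mathlib.MeasureTheory.Covering.BesicovitchVectorSpace
import Mathlib.MeasureTheory.Measure.Lebesgue.EqHaar
import HarnessLib

/-!
# Convex integration in 2-D: strict subsolutions, uniform geometry, cell families

Topic `Analysis/FluidPDE`. Support file (layer 4a of 5) for the proof of
`ConvexIntegrationLemma2DBall` (Chiodaroli–De Lellis–Kreml 2015, Lemma 3.7 on a ball): the
ingredients of the perturbation step (claim (Cl) of CDK §4.1), assembled in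
`ConvexIntegration2DStep.lean`.

* `MemX0 C qt Ω p` — the space `X₀` of CDK §4.1: smooth perturbations `p = (v̲, u̲)` compactly
  supported in `Ω`, solving the linear system, with `qt + p(z) ∈ 𝒰` for all `z` (`qt = (ṽ, ũ)`);
  `defect C qt Ω p = ∫_Ω (C - |ṽ + v̲|²)`, `stepGain C Ω = (16384 C |Ω|)⁻¹`;
* `uniform_geometry`: the local geometric lemma (`geometric_lemma_local`) made uniform on a
  compact set of states (finite subcover + Lebesgue number) — CDK's "by continuity there exists
  `r₀` …";
* `exists_finite_ball_family`: finitely many pairwise disjoint closed balls in `Ω` of radii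
  `< r₀` capturing half of `∫_Ω g` (measurable Besicovitch covering theorem) — CDK's Riemann-sum
  display in the proof of (Cl);
* `waveSum`: finite sums of localized plane waves on disjoint balls (smooth, compactly supported,
  solving the linear system; on each ball the sum is the single wave; squares add up);
* volumes of balls in `ℝ × ℝ²` (`|B(x, s)| = s³|B(0,1)|`, `|B(x, s/2)| = |B(x, s)|/8`).

## References

* E. Chiodaroli, C. De Lellis, O. Kreml, *Global ill-posedness of the isentropic system of gas
  dynamics*, Comm. Pure Appl. Math. 68 (2015) 1157–1190, §4.1.
-/

noncomputable section

open MeasureTheory Set Metric Filter Function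
open scoped ContDiff Topology

namespace Literature.Analysis.FluidPDE.ConvexIntegration


/-! ### Strict subsolutions (the space `X₀`) -/

/-- The state-valued map of a perturbation `p` over the base state `qt = (ṽ, ũ)`:
`z ↦ qt + p(z)`. [folklore] -/
def stateOf (qt : State) (p : Fin 4 → ST → ℝ) (z : ST) : State := qt + fun i => p i z

/-- **The space `X₀` of CDK 2015, §4.1** (for the data `(C, qt)` and the open set `Ω`): smooth
perturbations `p = (v̲, u̲)` compactly supported in `Ω`, solving the linear system (ii), with
`(ṽ + v̲) ⊗ (ṽ + v̲) - (ũ + u̲) < (C/2) Id` pointwise, i.e. `qt + p(z) ∈ 𝒰` for all `z`.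
[cite: ChiodaroliDeLellisKreml2015, §4.1] -/
structure MemX0 (C : ℝ) (qt : State) (Ω : Set ST) (p : Fin 4 → ST → ℝ) : Prop where
  /-- smoothness -/
  smooth : ∀ i, ContDiff ℝ ∞ (p i)
  /-- compact support -/
  hasCompactSupport : ∀ i, HasCompactSupport (p i)
  /-- support inside `Ω` -/
  tsupport_subset : ∀ i, tsupport (p i) ⊆ Ω
  /-- the linear system holds classically -/
  solves : SolvesLinear p
  /-- strict subsolution pointwise -/
  inU : ∀ z, InU C (stateOf qt p z)

/-- The *defect functional* `J(p) = ∫_Ω (C - |ṽ + v̲|²) = ∫_Ω tr M`.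
[cite: ChiodaroliDeLellisKreml2015, §4.1 (claim (Cl))] -/
def defect (C : ℝ) (qt : State) (Ω : Set ST) (p : Fin 4 → ST → ℝ) : ℝ :=
  ∫ z in Ω, trM C (stateOf qt p z)

/-- The gain constant `β = (16384 C |Ω|)⁻¹` of the perturbation step. [folklore] -/
def stepGain (C : ℝ) (Ω : Set ST) : ℝ := (16384 * C * volume.real Ω)⁻¹

section Basic

variable {C : ℝ} {qt : State} {Ω : Set ST} {p : Fin 4 → ST → ℝ}

/-- Coordinates of the state map. [folklore] -/
theorem stateOf_apply (qt : State) (p : Fin 4 → ST → ℝ) (z : ST) (i : Fin 4) :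
    stateOf qt p z i = qt i + p i z := rfl

/-- The zero perturbation belongs to `X₀` when the base state is a strict subsolution.
[folklore] -/
theorem MemX0.zero (hqt : InU C qt) (Ω : Set ST) : MemX0 C qt Ω (fun _ _ => 0) where
  smooth _ := contDiff_const
  hasCompactSupport _ := HasCompactSupport.zero
  tsupport_subset _ := by simp
  solves := SolvesLinear.zero
  inU z := by
    have : stateOf qt (fun _ _ => (0 : ℝ)) z = qt := by ext i; simp [stateOf_apply]
    rw [this]; exact hqt

/-- The state map of an element of `X₀` is continuous. [folklore] -/
theorem MemX0.continuous_stateOf (hp : MemX0 C qt Ω p) : Continuous (stateOf qt p) :=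
  continuous_const.add (continuous_pi fun i => (hp.smooth i).continuous)

/-- Elements of `X₀` vanish off `Ω`. [folklore] -/
theorem MemX0.p_eq_zero (hp : MemX0 C qt Ω p) {z : ST} (hz : z ∉ Ω) (i : Fin 4) : p i z = 0 :=
  image_eq_zero_of_notMem_tsupport fun h => hz (hp.tsupport_subset i h)

/-- The vector perturbation `z ↦ p(z)` of an element of `X₀` has compact support. [folklore] -/
theorem MemX0.hasCompactSupport_pi (hp : MemX0 C qt Ω p) :
    HasCompactSupport (fun z => fun i => p i z : ST → State) := by
  have hK : IsCompact (⋃ i, tsupport (p i)) := isCompact_iUnion fun i => hp.hasCompactSupport i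
  refine HasCompactSupport.intro hK fun z hz => ?_
  ext i
  simp only [mem_iUnion, not_exists] at hz
  exact image_eq_zero_of_notMem_tsupport (hz i)

/-- The state map of an element of `X₀` is uniformly continuous. [folklore] -/
theorem MemX0.exists_radius (hp : MemX0 C qt Ω p) {δ : ℝ} (hδ : 0 < δ) :
    ∃ r₀ : ℝ, 0 < r₀ ∧ ∀ z z', dist z z' < r₀ → dist (stateOf qt p z) (stateOf qt p z') < δ := by
  have huc : UniformContinuous (fun z => fun i => p i z : ST → State) :=
    hp.hasCompactSupport_pi.uniformContinuous_of_continuous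
      (continuous_pi fun i => (hp.smooth i).continuous)
  obtain ⟨r₀, hr₀, h⟩ := Metric.uniformContinuous_iff.mp huc δ hδ
  refine ⟨r₀, hr₀, fun z z' hzz' => ?_⟩
  have := h hzz'
  simpa [stateOf] using this

/-- The range of the state map of an element of `X₀` lies in a compact subset of `𝒰`.
[folklore] -/
theorem MemX0.exists_compact_superset (hp : MemX0 C qt Ω p) (hqt : InU C qt) :
    ∃ Q : Set State, IsCompact Q ∧ range (stateOf qt p) ⊆ Q ∧ Q ⊆ {q | InU C q} := by
  set K := tsupport (fun z => fun i => p i z : ST → State)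
  refine ⟨stateOf qt p '' K ∪ {qt}, (hp.hasCompactSupport_pi.image hp.continuous_stateOf).union
    isCompact_singleton, ?_, ?_⟩
  · rintro _ ⟨z, rfl⟩
    by_cases hz : z ∈ K
    · exact Or.inl ⟨z, hz, rfl⟩
    · right
      have : (fun i => p i z) = 0 := image_eq_zero_of_notMem_tsupport hz
      simp [stateOf, this]
  · rintro q (⟨z, -, rfl⟩ | hq)
    · exact hp.inU z
    · rw [mem_singleton_iff.mp hq]; exact hqt

end Basic

/-! ### Uniform geometry on a compact set of states -/

/-- **Uniform geometric lemma.** On a compact `Q ⊆ 𝒰` there are `δ, ρ₀ > 0` such that every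
`q ∈ Q` carries one segment datum `(n, μ, ℓ)` (`0 < |μ| < √C`) that serves all states within `δ` of `q`,
with room `ρ₀`: `ℓ ≥ tr M(q')/(16√C)` and the `ρ₀`-neighbourhood of `q' + sD(n,μ)`, `|s| ≤ ℓ`,
lies in `𝒰`. [cite: ChiodaroliDeLellisKreml2015, §4.1 ("By continuity there exists r₀ such that the conclusion above holds for every r < r₀ and every (x,t)")] -/
theorem uniform_geometry {C : ℝ} {Q : Set State} (hQ : IsCompact Q)
    (hQU : Q ⊆ {q | InU C q}) :
    ∃ δ : ℝ, 0 < δ ∧ ∃ ρ₀ : ℝ, 0 < ρ₀ ∧ ∀ q ∈ Q, ∃ (n : E2) (μ ℓ : ℝ),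
      n 0 ^ 2 + n 1 ^ 2 = 1 ∧ (μ ≠ 0 ∧ μ ^ 2 < C) ∧ 0 ≤ ℓ ∧
      (∀ q' ∈ ball q δ, trM C q' / (16 * Real.sqrt C) ≤ ℓ) ∧
      (∀ q' ∈ ball q δ, ∀ s : ℝ, |s| ≤ ℓ →
        ∀ y ∈ closedBall (q' + s • dirVec n μ) ρ₀, InU C y) := by
  choose! ρ hρ n μ ℓ hn hμ hℓ h1 h2 using fun q (hq : InU C q) => geometric_lemma_local hq
  -- finite subcover of `Q` by the balls `B(q, ρ_q / 2)`, `q ∈ Q`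
  obtain ⟨T, hT⟩ := hQ.elim_finite_subcover (fun q : Q => ball (q : State) (ρ q / 2))
    (fun _ => isOpen_ball) (fun q hq => mem_iUnion.mpr ⟨⟨q, hq⟩, mem_ball_self
      (half_pos (hρ q (hQU hq)))⟩)
  rcases T.eq_empty_or_nonempty with hTe | hTne
  · -- `Q` is empty
    refine ⟨1, one_pos, 1, one_pos, fun q hq => ?_⟩
    have : q ∈ (⋃ i ∈ T, ball (i : State) (ρ i / 2)) := hT hq
    simp [hTe] at this
  set ρ₀ : ℝ := T.inf' hTne (fun q => ρ q / 2)
  have hρ₀ : 0 < ρ₀ := by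
    simp only [ρ₀, Finset.lt_inf'_iff]
    exact fun q _ => half_pos (hρ q (hQU q.2))
  have hρ₀le : ∀ q ∈ T, ρ₀ ≤ ρ q / 2 := fun q hq => Finset.inf'_le _ hq
  -- Lebesgue number of the finite cover
  obtain ⟨δ, hδ, hleb⟩ := lebesgue_number_lemma_of_metric hQ
    (c := fun q : T => ball ((q : Q) : State) (ρ q / 2)) (fun _ => isOpen_ball) (by
      intro x hx
      have := hT hx
      simp only [mem_iUnion] at this
      obtain ⟨i, hi, hxi⟩ := this
      exact mem_iUnion.mpr ⟨⟨i, hi⟩, hxi⟩)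
  refine ⟨δ, hδ, ρ₀, hρ₀, fun q hq => ?_⟩
  obtain ⟨i, hi⟩ := hleb q hq
  have hiU : InU C (i : Q) := hQU (i : Q).2
  have hρi : 0 < ρ (i : Q) := hρ _ hiU
  have hsub : ball q δ ⊆ ball ((i : Q) : State) (ρ (i : Q)) :=
    hi.trans (ball_subset_ball (by linarith))
  refine ⟨n (i : Q), μ (i : Q), ℓ (i : Q), hn _ hiU, hμ _ hiU, hℓ _ hiU,
    fun q' hq' => h1 _ hiU q' (hsub hq'), fun q' hq' s hs y hy => h2 _ hiU q' (hsub hq') s hs y ?_⟩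
  exact closedBall_subset_closedBall ((hρ₀le i i.2).trans (by linarith)) hy

/-! ### Finitely many disjoint balls capturing half of an integral -/

/-- **Disjoint balls capturing half of an integral** (measurable Besicovitch covering): for an
open set `Ω`, `r₀ > 0` and a function `g` integrable on `Ω`, finitely
many pairwise disjoint closed balls `closedBall cᵢ rᵢ ⊆ Ω` with `0 < rᵢ < r₀` and
`∑ᵢ ∫_{closedBall cᵢ rᵢ} g ≥ (∫_Ω g)/2`. [cite: ChiodaroliDeLellisKreml2015, §4.1 (the Riemann-sum display in the proof of (Cl))] -/
theorem exists_finite_ball_family {Ω : Set ST} (hΩo : IsOpen Ω)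
    {r₀ : ℝ} (hr₀ : 0 < r₀) {g : ST → ℝ} (hgi : IntegrableOn g Ω) :
    ∃ (m : ℕ) (c : Fin m → ST) (r : Fin m → ℝ), (∀ i, 0 < r i) ∧ (∀ i, r i < r₀) ∧
      (∀ i, closedBall (c i) (r i) ⊆ Ω) ∧
      (Pairwise fun i j => Disjoint (closedBall (c i) (r i)) (closedBall (c j) (r j))) ∧
      (∫ z in Ω, g z) / 2 ≤ ∑ i, ∫ z in closedBall (c i) (r i), g z := by
  -- Besicovitch: a.e. cover of `Ω` by disjoint closed balls inside `Ω` of radius `< r₀`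
  obtain ⟨t, r, tcount, hts, hr, hnull, hdisj⟩ :=
    Besicovitch.exists_disjoint_closedBall_covering_ae
      (volume : Measure ST) (fun x => {ρ | closedBall x ρ ⊆ Ω}) Ω (fun x hx δ hδ => by
        obtain ⟨ε, hε, hball⟩ := Metric.isOpen_iff.mp hΩo x hx
        refine ⟨min (ε / 2) (δ / 2), ?_, ?_, ?_⟩
        · exact (closedBall_subset_ball
            ((min_le_left _ _).trans_lt (half_lt_self hε))).trans hball
        · exact lt_min (half_pos hε) (half_pos hδ)
        · exact (min_le_right _ _).trans_lt (half_lt_self hδ))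
      (fun _ => r₀) (fun _ _ => hr₀)
  haveI : Countable t := tcount.to_subtype
  set B : t → Set ST := fun x => closedBall (x : ST) (r x)
  have hBm : ∀ x, MeasurableSet (B x) := fun x => measurableSet_closedBall
  have hBd : Pairwise (Disjoint on B) := fun i j hij =>
    hdisj i.2 j.2 (Subtype.coe_injective.ne hij)
  have hUΩ : (⋃ x, B x) ⊆ Ω := iUnion_subset fun x => (hr x x.2).1
  have hΩU : Ω =ᵐ[volume] (⋃ x, B x) := by
    refine ae_eq_set.mpr ⟨?_, ?_⟩
    · have : (⋃ x : t, B x) = ⋃ x ∈ t, closedBall x (r x) := by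
        simp only [B, biUnion_eq_iUnion]
      rw [this]; exact hnull
    · rw [sdiff_eq_empty.mpr hUΩ, measure_empty]
  have hsum : HasSum (fun x : t => ∫ z in B x, g z) (∫ z in Ω, g z) := by
    rw [setIntegral_congr_set hΩU]
    exact hasSum_integral_iUnion hBm hBd (hgi.mono_set hUΩ)
  set J := ∫ z in Ω, g z
  -- a finite partial sum capturing half of `J`
  obtain ⟨I, hI⟩ : ∃ I : Finset t, J / 2 ≤ ∑ x ∈ I, ∫ z in B x, g z := by
    rcases le_or_gt J 0 with hJ | hJ
    · exact ⟨∅, by simp; linarith⟩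
    · have hev := hsum.eventually (Ioi_mem_nhds (half_lt_self hJ))
      obtain ⟨I, hI⟩ := hev.exists
      exact ⟨I, le_of_lt hI⟩
  -- reindex by `Fin m`
  set m := I.card
  set e : Fin m ≃ {x // x ∈ I} := I.equivFin.symm
  refine ⟨m, fun i => ((e i : t) : ST), fun i => r ((e i : t) : ST), fun i => (hr _ (e i).1.2).2.1,
    fun i => (hr _ (e i).1.2).2.2, fun i => (hr _ (e i).1.2).1, ?_, ?_⟩
  · intro i j hij
    have hne : ((e i : t) : ST) ≠ ((e j : t) : ST) := by
      intro h
      apply hij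
      apply e.injective
      exact Subtype.ext (Subtype.ext h)
    exact hdisj (e i).1.2 (e j).1.2 hne
  · calc J / 2 ≤ ∑ x ∈ I, ∫ z in B x, g z := hI
      _ = ∑ x : {x // x ∈ I}, ∫ z in B x, g z := (Finset.sum_coe_sort I _).symm
      _ = ∑ i : Fin m, ∫ z in B (e i), g z := by
          rw [← Equiv.sum_comp e]
      _ = _ := rfl

/-! ### Finite families of localized plane waves on disjoint balls -/

section Family

variable {m : ℕ} (d : Fin m → WaveData)

/-- The sum of a finite family of localized plane waves (common frequency `N`). [folklore] -/
def waveSum (N : ℝ) (k : Fin 4) (z : ST) : ℝ := ∑ i, (d i).wave N k z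

/-- The sum of waves is smooth. [folklore] -/
theorem contDiff_waveSum (N : ℝ) (k : Fin 4) : ContDiff ℝ ∞ (waveSum d N k) :=
  ContDiff.sum fun i _ => (d i).contDiff_wave N k

/-- The sum of waves is compactly supported. [folklore] -/
theorem hasCompactSupport_waveSum (N : ℝ) (k : Fin 4) : HasCompactSupport (waveSum d N k) := by
  have : waveSum d N k = ∑ i, (d i).wave N k := by
    funext z; simp [waveSum, Finset.sum_apply]
  rw [this]
  exact HasCompactSupport.finset_sum fun i _ => (d i).hasCompactSupport_wave N k

/-- The sum of waves solves the linear system. [folklore] -/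
theorem solvesLinear_waveSum (N : ℝ) : SolvesLinear (waveSum d N) :=
  SolvesLinear.finset_sum Finset.univ (fun i _ => (d i).solvesLinear_wave N)
    (fun i _ k => differentiable_of_smooth ((d i).contDiff_wave N k))

/-- The support of the sum of waves lies in the union of the balls. [folklore] -/
theorem tsupport_waveSum_subset (N : ℝ) (k : Fin 4) :
    tsupport (waveSum d N k) ⊆ ⋃ i, ball (d i).c (d i).r := by
  have hcl : IsClosed (⋃ i, tsupport ((d i).wave N k)) :=
    isClosed_iUnion_of_finite fun i => isClosed_tsupport _
  refine (closure_minimal ?_ hcl).trans (iUnion_mono fun i => (d i).tsupport_wave_subset N k)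
  intro z hz
  rw [mem_support] at hz
  by_contra h
  simp only [mem_iUnion, not_exists] at h
  apply hz
  exact Finset.sum_eq_zero fun i _ => image_eq_zero_of_notMem_tsupport (h i)

/-- Off all balls the sum of waves vanishes. [folklore] -/
theorem waveSum_eq_zero {N : ℝ} {k : Fin 4} {z : ST} (hz : ∀ i, z ∉ ball (d i).c (d i).r) :
    waveSum d N k z = 0 :=
  Finset.sum_eq_zero fun i _ => (d i).wave_eq_zero (hz i)

variable (hd : Pairwise fun i j => Disjoint (ball (d i).c (d i).r) (ball (d j).c (d j).r))
include hd

/-- On the `i`-th ball the sum of waves is the `i`-th wave. [folklore] -/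
theorem waveSum_eq_of_mem {N : ℝ} {k : Fin 4} {z : ST} {i : Fin m}
    (hz : z ∈ ball (d i).c (d i).r) : waveSum d N k z = (d i).wave N k z := by
  refine Finset.sum_eq_single i (fun j _ hji => (d j).wave_eq_zero fun hzj => ?_)
    (fun h => (h (Finset.mem_univ i)).elim)
  exact Set.disjoint_left.mp (hd hji) hzj hz

/-- Pointwise, the square of the sum is the sum of the squares (disjoint supports).
[folklore] -/
theorem waveSum_sq (N : ℝ) (k : Fin 4) (z : ST) :
    waveSum d N k z ^ 2 = ∑ i, (d i).wave N k z ^ 2 := by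
  by_cases h : ∃ i, z ∈ ball (d i).c (d i).r
  · obtain ⟨i, hi⟩ := h
    rw [waveSum_eq_of_mem d hd hi]
    symm
    refine Finset.sum_eq_single (f := fun j => (d j).wave N k z ^ 2) i (fun j _ hji => ?_)
      (fun h => (h (Finset.mem_univ i)).elim)
    rw [(d j).wave_eq_zero fun hzj => Set.disjoint_left.mp (hd hji) hzj hi, zero_pow two_ne_zero]
  · push Not at h
    rw [waveSum_eq_zero d h, zero_pow two_ne_zero]
    exact (Finset.sum_eq_zero fun i _ => by rw [(d i).wave_eq_zero (h i), zero_pow two_ne_zero]).symm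

end Family

/-! ### Volumes of balls in `ℝ × ℝ²` -/

/-- `dim (ℝ × ℝ²) = 3`. [folklore] -/
theorem finrank_ST : Module.finrank ℝ ST = 3 := by
  rw [Module.finrank_prod, Module.finrank_self, finrank_euclideanSpace_fin]

/-- Volume of a ball in `ℝ × ℝ²`: `|B(x, s)| = s³ |B(0, 1)|`. [folklore] -/
theorem volume_real_ball (x : ST) {s : ℝ} (hs : 0 ≤ s) :
    volume.real (ball x s) = s ^ 3 * volume.real (ball (0 : ST) 1) := by
  rw [measureReal_def, Measure.addHaar_ball volume x hs, finrank_ST, ENNReal.toReal_mul,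
    ENNReal.toReal_ofReal (pow_nonneg hs 3), measureReal_def]

/-- `|B(x, s/2)| = |B(x, s)| / 8` in `ℝ × ℝ²`. [folklore] -/
theorem volume_real_ball_half (x : ST) {s : ℝ} (hs : 0 ≤ s) :
    volume.real (ball x (s / 2)) = volume.real (ball x s) / 8 := by
  rw [volume_real_ball x hs, volume_real_ball x (by linarith : 0 ≤ s / 2)]
  ring

/-- Closed and open balls have the same volume. [folklore] -/
theorem volume_real_closedBall_eq (x : ST) (s : ℝ) :
    volume.real (closedBall x s) = volume.real (ball x s) :=
  Measure.addHaar_real_closedBall_eq_addHaar_real_ball volume x s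


/-- The velocity energy density of a wave is integrable. [folklore] -/
theorem WaveData.integrable_energy (d : WaveData) (N : ℝ) :
    Integrable (fun z => d.wave N 0 z ^ 2 + d.wave N 1 z ^ 2) := by
  have h : ∀ k, HasCompactSupport (fun z => d.wave N k z ^ 2) := fun k =>
    (d.hasCompactSupport_wave N k).comp_left (g := fun t : ℝ => t ^ 2) (by norm_num)
  exact (((d.continuous_wave N 0).pow 2).add ((d.continuous_wave N 1).pow 2)).integrable_of_hasCompactSupport
    ((h 0).add (h 1))

end Literature.Analysis.FluidPDE.ConvexIntegration
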